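import Mathlib
import Literature.NumberTheory.LFunctions.Zhang2022.AppendixBLemma151Mu3Value
import Literature.NumberTheory.LFunctions.Zhang2022.AppendixBPerronGeneric
import Literature.NumberTheory.LFunctions.Zhang2022.AppendixBLineShiftGeneric
import Literature.NumberTheory.LFunctions.Zhang2022.AppendixBLineToCircleGeneric

/-!
# Zhang (2022) Appendix B, proof of Lemma 15.1: **`StepB_mu3R` HOLDS** — the `μ = 3` leg
# `Σ_l ϰ₃(l₁l)ϱ_j(l)/l = e_{3j} + O(α₁)` is a theorem

Topic `Literature/NumberTheory/LFunctions/Zhang2022` (Landau–Siegel audit tree; verdict-neutral).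
Y. Zhang, *Discrete mean estimates and the Landau–Siegel zero*, arXiv:2211.02515v1 (2022)
[Zhang2022LandauSiegel] — **an unrefereed manuscript under adjudication; this file PROVES one displayed
step of its Appendix B and asserts nothing else.** ZHANG-L discharge lane (WP15, App. B leg B3 under leaf
`Typed.Section15C.Eq15_22` / Lemma 15.1 χR; one of the four legs of `Section15CEq1522Assembly.eq15_22D_of_appB_legs`),
DAG node `Z22:§B.u011` (text) [Z22 p.107, tex L5310]: "In case `μ = 3` the proof can be obtained with
`β₆` and `P₃` in place of `β₇` and `P₂` respectively", reading of record `α₁ = α log T`.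

`stepB_mu3R_holds : ∀ c′, Typed.AppendixB.StepB_mu3R c′` — assembled from theorems only:
the `μ = 3` Perron identity `Skeleton.vkSum_vk3_eq_vline` (`AppendixBPerronGeneric`, zl-libA-p6), the
GENERIC line-to-circle bound `Typed.AppendixB.vline_sub_circle_le_of_shift` (`AppendixBLineToCircleGeneric`,
zl-libA-p6) fed with the vertical-line shift and integrability of `AppendixBLineShiftGeneric` (block P2a)
and instantiated at `(P₃, β₆)` (`log P₃ = 0.498𝓛⁹ ≥ 𝓛⁹/4`, `P₃/l₁ ≥ P₃/T ≥ T`, `Re β₆ = 0`,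
`β₆ ≠ 0, β_j`, `‖β₆‖ = 3α/2 ≤ 3α`; rate `C·α ≤ C·α₁`), the two-circle split, the residue at `0` and the
value of the `β₆`-residue (`AppendixBLemma151Mu3Circles/Value`) through `Skeleton.stepB_mu3R_of_perron_shift`.

WHAT THIS IS NOT: Lemma 15.1, (15.22), or any claim about Theorems 1–2 / Landau–Siegel zeros.

## References

* Y. Zhang, arXiv:2211.02515v1 (2022), App. B p. 107; Lemma 15.1 p. 80.
  [cite: Zhang2022LandauSiegel, App. B p.107]
-/

noncomputable section

open Complex Real Metric Set Filter Topology

namespace Literature.NumberTheory.LFunctions.Zhang2022.Skeleton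

open Typed.AppendixB (zetaRatio kerB vline vkSum)

/-- `L₀ ≤ log D` once `D ≥ ⌈exp L₀⌉₊`. [folklore] -/
private theorem le_ell_of_ceil_exp_le₇ {L₀ : ℝ} {D : ℕ} (hD : ⌈Real.exp L₀⌉₊ ≤ D) : L₀ ≤ ell D := by
  have h : Real.exp L₀ ≤ D := le_trans (Nat.le_ceil _) (by exact_mod_cast hD)
  exact (Real.le_log_iff_exp_le (lt_of_lt_of_le (Real.exp_pos _) h)).mpr h

/-- `P₃ ≥ T²` once `𝓛 ≥ 2` (`log P₃ = 0.498𝓛⁹ ≥ 2𝓛^{1.1} = log T²`). [cite: Zhang2022LandauSiegel, §2 (2.21), §6] -/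
theorem bigT_sq_le_P3 {D : ℕ} (hℓ : 2 ≤ ell D) : bigT D * bigT D ≤ P3 D := by
  have hℓ1 : 1 ≤ ell D := by linarith
  have hℓ0 : 0 < ell D := by linarith
  have h11 : ell D ^ (1.1 : ℝ) ≤ ell D ^ 2 := by
    calc ell D ^ (1.1 : ℝ) ≤ ell D ^ (2 : ℝ) := Real.rpow_le_rpow_of_exponent_le hℓ1 (by norm_num)
      _ = ell D ^ 2 := by norm_cast
  have hℓ7 : (128 : ℝ) ≤ ell D ^ 7 := by
    calc (128 : ℝ) = 2 ^ 7 := by norm_num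
      _ ≤ ell D ^ 7 := by gcongr
  have hmain : 2 * ell D ^ (1.1 : ℝ) ≤ 0.498 * ell D ^ 9 := by
    have h9 : ell D ^ 9 = ell D ^ 2 * ell D ^ 7 := by ring
    have h2pos : 0 ≤ ell D ^ 2 := by positivity
    nlinarith
  rw [bigT, ← Real.exp_add, P3, bigP, ← Real.exp_mul]
  exact Real.exp_le_exp.mpr (by linarith)

/-- **`StepB_mu3R` holds** (App. B p. 107, `μ = 3`: `Σ_l ϰ₃(l₁l)ϱ_j(l)/l = e_{3j} + O(α₁)` for
`1 ≤ l₁ < T`, `l₁ ∈ 𝒩(𝔮)`, `j ∈ {1,2,3}`, `D` large). [cite: Zhang2022LandauSiegel, App. B p.107] -/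
theorem stepB_mu3R_holds (c' : ℝ) : Typed.AppendixB.StepB_mu3R c' := by
  refine stepB_mu3R_of_perron_shift c' (vkSum_vk3_eq_vline c') ?_
  obtain ⟨C, D₀, h⟩ := Typed.AppendixB.vline_sub_circle_le_of_shift c'
    (fun hP hl hβ hσ => Typed.AppendixB.integrable_zetaRatio_kerB_line c' hP hl hβ hσ)
    (fun hP hl hβ hε hε1 => Typed.AppendixB.vline_shift_zetaRatio_kerB c' hP hl hβ hε hε1)
  refine ⟨max C 0, max D₀ (max 8 ⌈Real.exp (max 2 (60 * |c'| * π))⌉₊),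
    fun D _ χ hD hq hp j hj l₁ hl₁ _ hT => ?_⟩
  have hD₀ : D₀ ≤ D := le_trans (le_max_left _ _) hD
  have hD8 : 8 ≤ D := le_trans (le_max_left _ _) (le_trans (le_max_right _ _) hD)
  have hℓ : max 2 (60 * |c'| * π) ≤ ell D :=
    le_ell_of_ceil_exp_le₇ (le_trans (le_max_right _ _) (le_trans (le_max_right _ _) hD))
  have hℓ2 : 2 ≤ ell D := le_trans (le_max_left _ _) hℓ
  have hℓ0 : 0 < ell D := by linarith
  have hℓ1 : 1 ≤ ell D := by linarith
  have hα : alpha D = π / ell D ^ 9 := by rw [alpha, bigP, Real.log_exp]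
  have hα0 : 0 < alpha D := by rw [hα]; positivity
  have hc : 60 * |c'| * (alpha D * ell D) ≤ 1 := by
    have hcℓ : 60 * |c'| * π ≤ ell D := le_trans (le_max_right _ _) hℓ
    have hαℓ : alpha D * ell D ≤ π / ell D := by
      have h1 : alpha D * ell D = π / ell D ^ 8 := by
        rw [hα, eq_div_iff (pow_ne_zero _ hℓ0.ne')]; field_simp
      rw [h1]
      exact div_le_div_of_nonneg_left Real.pi_pos.le hℓ0
        (le_self_pow₀ (by linarith) (by norm_num))
    calc 60 * |c'| * (alpha D * ell D) ≤ 60 * |c'| * (π / ell D) := by gcongr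
      _ = 60 * |c'| * π / ell D := by ring
      _ ≤ 1 := by rw [div_le_one hℓ0]; exact hcℓ
  obtain ⟨hb6, hn6⟩ := beta6_size c' hℓ2 hc hj
  have hβ0 : beta6 D ≠ 0 := by intro h0; rw [h0, norm_zero] at hn6; linarith
  have hβb : beta6 D ≠ betaJ c' D j := by
    intro h0; rw [h0, sub_self, norm_zero] at hb6; linarith
  have hβre : (beta6 D).re = 0 := by
    have h6 : beta6 D = (((3 / 2 * alpha D : ℝ)) : ℂ) * I := by rw [beta6]; push_cast; ring
    rw [h6]; simp
  have hβ3 : ‖beta6 D‖ ≤ 3 * alpha D := by rw [hn6]; linarith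
  have hD2 : 2 ≤ D := le_trans (by norm_num) hD8
  -- `log P₃ ≥ 𝓛⁹/4` and `P₃/l₁ ≥ T`
  have hlogP3 : ell D ^ 9 / 4 ≤ Real.log (P3 D) := by
    rw [log_P3]; nlinarith [pow_pos hℓ0 9]
  have hl₁pos : (0 : ℝ) < l₁ := by exact_mod_cast hl₁
  have hT0 : 0 < bigT D := Real.exp_pos _
  have hP3T : bigT D ≤ P3 D / l₁ := by
    have h1 : bigT D ≤ P3 D / bigT D := by
      rw [le_div_iff₀ hT0]; exact bigT_sq_le_P3 hℓ2
    have hP3 : 0 ≤ P3 D := (Real.rpow_pos_of_pos (Real.exp_pos _) _).le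
    exact h1.trans (div_le_div_of_nonneg_left hP3 hl₁pos hT.le)
  have hmain := h D hD₀ j hj (P3 D) l₁ (beta6 D) (one_lt_P3 hD2) hlogP3 hl₁ hP3T hβ0 hβb hβre hβ3
  -- rate `α ≤ α₁`
  have hαα1 : alpha D ≤ alpha1 D := by
    rw [alpha1, log_bigT]
    have h11 : (1 : ℝ) ≤ ell D ^ (1.1 : ℝ) := Real.one_le_rpow hℓ1 (by norm_num)
    nlinarith
  calc _ ≤ C * alpha D := hmain
    _ ≤ max C 0 * alpha D := mul_le_mul_of_nonneg_right (le_max_left _ _) hα0.le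
    _ ≤ max C 0 * alpha1 D := mul_le_mul_of_nonneg_left hαα1 (le_max_right _ _)

variable (c' : ℝ) in
/-- `StepB_mu3R` — `_holds` alias of `stepB_mu3R_holds` above under the fact's exact name, stated under the
prover's own binders as section variables (appended 2026-08-28, D-0026 bookkeeping: the proof term is the
existing theorem of this file; no statement, definition or attribute is edited; no new named fact; the
ledger's debt table listed the fact unproved). [cite: Zhang2022LandauSiegel, App. B p.107] -/
theorem _root_.Literature.NumberTheory.LFunctions.Zhang2022.Typed.AppendixB.StepB_mu3R_holds :
    _root_.Literature.NumberTheory.LFunctions.Zhang2022.Typed.AppendixB.StepB_mu3R c' :=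
  _root_.Literature.NumberTheory.LFunctions.Zhang2022.Skeleton.stepB_mu3R_holds (c' := c')

end Literature.NumberTheory.LFunctions.Zhang2022.Skeleton
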